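import Summits.AtomisticToContinuum.FouriersLaw.Theses.GriffithsLimitExchange

/-!
# Line `birth` — birth-certificate skeleton (BC3) for the crux
`GriffithsLimitExchange.FiniteHorizonTransmission` (item stmt-AtomisticToContinuum-13199, rank 3,
route `route-AtomisticToContinuum-GriffithsLimitExchange`, sub-problem `FouriersLaw`)

Crux (FIXED, concluded BY NAME below): for `P = pinnedChain ω₂ lam β γ` (all `> 0`), `T > 0`, with
`Kt_N(u) = Cov_{Gibbs_T}(p_0²(0), p_{N-1}²(u))` (constructed kernels) and the finite-horizon end-to-end
transmission `X_N(t) = (γ/T²) ∫_{(0,t]} Kt_N(u) du`: for every macroscopic horizon `A > 0` the rescaled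
transmission `N · X_N(A·N²)` has a (finite) limit as `N → ∞`.

REGIME DECOMPOSITION of macroscopic time `s = t/N²` into the PRECURSOR window `(0, δ]` and the DIFFUSIVE
window `(δ, A]` — the two clauses of the crux's own "why it might fail" line, separated:

* `stub_noBallisticPrecursor` (S1, the FINITENESS / no-fast-channel content; size L–XL): the rescaled
  precursor transmission is uniformly small on short horizons — `∀ ε > 0 ∃ δ₀ > 0 ∀ δ ∈ (0, δ₀]`, eventually in
  `N`, `|N · X_N(δN²)| ≤ ε`. Every ballistic (`t ≍ N`) or superdiffusive (`t ≍ N^α`, `α < 2`) channel lives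
  in `(0, δN²]` for every `δ > 0` as `N → ∞`, so S1 is exactly what FAILS for the harmonic member
  (`lam = β = 0`: `N·X_N(δN²) ≈ N·E_∞ → ∞`, Rieder–Lebowitz–Lieb; barrier `HarmonicChainBallisticFlux`) and what
  phonon damping uniform in `N` (kinetic mean free path `ℓ(T) < ∞`, Aoki–Lukkarinen–Spohn 2006 §3) plus a
  diffusive ON-DIAGONAL upper bound (energy-spreading second moment `≲ t`) should give: expected limit value
  `x_T(δ) = e(T)·F(δ)` with `F(δ) ≍ e^{-1/(4Dδ)} → 0`. It is NOT implied by the crux (the crux allows any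
  `x_T(δ)`), and does not imply it (says nothing about `(δ, A]`).
* `stub_diffusiveWindowLimit` (S2, the EXISTENCE / macro-ergodicity content; size XL, hardest): on every window
  bounded away from the precursor, `0 < δ < A`, the rescaled window transmission
  `N · (X_N(AN²) − X_N(δN²)) = N(γ/T²)∫_{(δN², AN²]} Kt_N` converges — a two-point equilibrium-fluctuation
  (linearised hydrodynamic) statement for ONE boundary observable at macroscopic times in `[δ, A]`, where
  heat-kernel technology applies and no short-time/boundary-layer-in-time control is needed. Strictly WEAKER
  than the crux (blind to `(0, δN²]`: a ballistic channel plus normal diffusion of the rest satisfies S2 and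
  violates S1), so it cannot imply the crux or `FouriersLaw` alone.
* `FiniteHorizonTransmission_of : FiniteHorizonTransmission` — the kernel-checked composition (no `sorry` of its
  own): for fixed `A`, `N·X_N(AN²) = [window term] + [precursor term]`; the window term converges (S2) hence is
  Cauchy, the precursor term is eventually `≤ ε/3` (S1 with `δ = min δ₀ (A/2)`), so `N·X_N(AN²)` is a Cauchy
  sequence of reals and converges (completeness) — the abstract real-analysis lemma
  `tendsto_of_precursor_and_window`, proved below (ε/3 argument, ~45 lines).

Disproof.lean / dead lines / negatives: none exist for this crux at registration time (`ledger crux ls`: no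
workfiles; `ledger negatives`: nothing on finite-horizon transmission). Both stubs keep the crux's binder prefix
(`lam, β > 0`), so the refuted harmonic member is outside their scope, as for the crux.
-/

namespace Summit.AtomisticToContinuum.FouriersLaw.Cruxes.FiniteHorizonTransmission.Birth

open MeasureTheory Filter Set Topology
open Summit.AtomisticToContinuum.FouriersLaw.Theses.GriffithsLimitExchange (FiniteHorizonTransmission)

/-! ## S1 — no ballistic / superdiffusive precursor -/

/-- **S1 `stub_noBallisticPrecursor`** (finiteness content of the crux). For all parameters `> 0`, `T > 0`:
for every `ε > 0` there is `δ₀ > 0` such that for every `0 < δ ≤ δ₀`, eventually in `N`,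
`|N · X_N(δ·N²)| ≤ ε` — the energy that has crossed the chain within a SHORT diffusive horizon is uniformly
`o(1)/N`-small. Kills every transport channel faster than diffusive; false for the harmonic chain. -/
theorem stub_noBallisticPrecursor :
    ∀ ω₂ lam β γ : ℝ, 0 < ω₂ → 0 < lam → 0 < β → 0 < γ → ∀ T : ℝ, 0 < T → (let P := Literature.MathematicalPhysics.KineticTheory.HeatConduction.pinnedChain ω₂ lam β γ; let Kt : ℕ → ℝ → ℝ := fun N u => if h : 0 < N then ∫ z, ((z.2 ⟨0, h⟩) ^ 2 - T) * (∫ y, ((y.2 ⟨N - 1, by omega⟩) ^ 2 - T) ∂(P.transitionKernel N T T u.toNNReal z)) ∂(P.gibbsMeasure N T) else 0; let X : ℕ → ℝ → ℝ := fun N t => γ / T ^ 2 * ∫ u in Set.Ioc (0 : ℝ) t, Kt N u; ∀ ε : ℝ, 0 < ε → ∃ δ₀ : ℝ, 0 < δ₀ ∧ ∀ δ : ℝ, 0 < δ → δ ≤ δ₀ → ∀ᶠ N : ℕ in Filter.atTop, |(N : ℝ) * X N (δ * (N : ℝ) ^ 2)| ≤ ε) := by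
  sorry

/-! ## S2 — the diffusive-window two-point scaling limit (HARDEST) -/

/-- **S2 `stub_diffusiveWindowLimit`** (existence content of the crux). For all parameters `> 0`, `T > 0` and
every window `0 < δ < A`, the rescaled window transmission `N · (X_N(A·N²) − X_N(δ·N²))` converges as `N → ∞`
— the diffusive scaling limit of the equilibrium boundary-to-boundary kinetic-energy correlation, integrated over
macroscopic times in `(δ, A]` only. -/
theorem stub_diffusiveWindowLimit :
    ∀ ω₂ lam β γ : ℝ, 0 < ω₂ → 0 < lam → 0 < β → 0 < γ → ∀ T : ℝ, 0 < T → (let P := Literature.MathematicalPhysics.KineticTheory.HeatConduction.pinnedChain ω₂ lam β γ; let Kt : ℕ → ℝ → ℝ := fun N u => if h : 0 < N then ∫ z, ((z.2 ⟨0, h⟩) ^ 2 - T) * (∫ y, ((y.2 ⟨N - 1, by omega⟩) ^ 2 - T) ∂(P.transitionKernel N T T u.toNNReal z)) ∂(P.gibbsMeasure N T) else 0; let X : ℕ → ℝ → ℝ := fun N t => γ / T ^ 2 * ∫ u in Set.Ioc (0 : ℝ) t, Kt N u; ∀ δ A : ℝ, 0 < δ → δ < A → ∃ y : ℝ, Filter.Tendsto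 (fun N : ℕ => (N : ℝ) * (X N (A * (N : ℝ) ^ 2) - X N (δ * (N : ℝ) ^ 2))) Filter.atTop (nhds y)) := by
  sorry

/-! ## The glue (real analysis, fully proved) -/

/-- Abstract glue: if the rescaled precursor `N·X_N(δN²)` is uniformly small for small `δ` (S1-shape) and every
rescaled window `N·(X_N(AN²) − X_N(δN²))`, `0 < δ < A`, converges (S2-shape), then `N·X_N(AN²)` converges for
every `A > 0`: it is a Cauchy sequence of reals (ε/3 argument). -/
theorem tendsto_of_precursor_and_window (X : ℕ → ℝ → ℝ)
    (hA : ∀ ε : ℝ, 0 < ε → ∃ δ₀ : ℝ, 0 < δ₀ ∧ ∀ δ : ℝ, 0 < δ → δ ≤ δ₀ →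
      ∀ᶠ N : ℕ in atTop, |(N : ℝ) * X N (δ * (N : ℝ) ^ 2)| ≤ ε)
    (hB : ∀ δ A : ℝ, 0 < δ → δ < A → ∃ y : ℝ,
      Tendsto (fun N : ℕ => (N : ℝ) * (X N (A * (N : ℝ) ^ 2) - X N (δ * (N : ℝ) ^ 2))) atTop (𝓝 y)) :
    ∀ A : ℝ, 0 < A → ∃ x : ℝ, Tendsto (fun N : ℕ => (N : ℝ) * X N (A * (N : ℝ) ^ 2)) atTop (𝓝 x) := by
  intro A hApos
  -- it suffices that the sequence is Cauchy (ℝ is complete)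
  apply cauchySeq_tendsto_of_complete
  rw [Metric.cauchySeq_iff]
  intro ε hε
  -- precursor scale δ = min δ₀ (A/2): small transmission there, and a genuine window (δ, A]
  obtain ⟨δ₀, hδ₀, hsmall⟩ := hA (ε / 3) (by positivity)
  have hδpos : 0 < min δ₀ (A / 2) := lt_min hδ₀ (by positivity)
  have hδle : min δ₀ (A / 2) ≤ δ₀ := min_le_left _ _
  have hδA : min δ₀ (A / 2) < A := lt_of_le_of_lt (min_le_right _ _) (by linarith)
  obtain ⟨y, hy⟩ := hB (min δ₀ (A / 2)) A hδpos hδA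
  have hprec : ∀ᶠ N : ℕ in atTop, |(N : ℝ) * X N (min δ₀ (A / 2) * (N : ℝ) ^ 2)| ≤ ε / 3 :=
    hsmall _ hδpos hδle
  have hwin : ∀ᶠ N : ℕ in atTop,
      dist ((N : ℝ) * (X N (A * (N : ℝ) ^ 2) - X N (min δ₀ (A / 2) * (N : ℝ) ^ 2))) y < ε / 6 :=
    Metric.tendsto_nhds.mp hy (ε / 6) (by positivity)
  obtain ⟨N₀, hN₀⟩ := Filter.eventually_atTop.mp (hprec.and hwin)
  refine ⟨N₀, fun m hm n hn => ?_⟩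
  obtain ⟨hm1, hm2⟩ := hN₀ m hm
  obtain ⟨hn1, hn2⟩ := hN₀ n hn
  rw [Real.dist_eq] at hm2 hn2 ⊢
  -- split each term into window + precursor
  have em : (m : ℝ) * X m (A * (m : ℝ) ^ 2)
      = (m : ℝ) * (X m (A * (m : ℝ) ^ 2) - X m (min δ₀ (A / 2) * (m : ℝ) ^ 2))
        + (m : ℝ) * X m (min δ₀ (A / 2) * (m : ℝ) ^ 2) := by ring
  have en : (n : ℝ) * X n (A * (n : ℝ) ^ 2)
      = (n : ℝ) * (X n (A * (n : ℝ) ^ 2) - X n (min δ₀ (A / 2) * (n : ℝ) ^ 2))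
        + (n : ℝ) * X n (min δ₀ (A / 2) * (n : ℝ) ^ 2) := by ring
  rw [em, en]
  -- abbreviate
  set wm := (m : ℝ) * (X m (A * (m : ℝ) ^ 2) - X m (min δ₀ (A / 2) * (m : ℝ) ^ 2)) with hwm
  set wn := (n : ℝ) * (X n (A * (n : ℝ) ^ 2) - X n (min δ₀ (A / 2) * (n : ℝ) ^ 2)) with hwn
  set pm := (m : ℝ) * X m (min δ₀ (A / 2) * (m : ℝ) ^ 2) with hpm
  set pn := (n : ℝ) * X n (min δ₀ (A / 2) * (n : ℝ) ^ 2) with hpn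
  have key : wm + pm - (wn + pn) = (wm - y) - (wn - y) + pm - pn := by ring
  rw [key]
  calc |wm - y - (wn - y) + pm - pn|
      ≤ |wm - y - (wn - y) + pm| + |pn| := abs_sub _ _
    _ ≤ |wm - y - (wn - y)| + |pm| + |pn| := by gcongr; exact abs_add_le _ _
    _ ≤ |wm - y| + |wn - y| + |pm| + |pn| := by gcongr; exact abs_sub _ _
    _ < ε / 6 + ε / 6 + ε / 3 + ε / 3 := by linarith
    _ = ε := by ring

/-! ## The skeleton theorem: the two stubs compose to the crux BY NAME -/

/-- **`FiniteHorizonTransmission_of`** — S1 and S2 imply the crux `FiniteHorizonTransmission` (concluded by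
name; the only `sorry`s are inside the two declared stubs). -/
theorem FiniteHorizonTransmission_of : FiniteHorizonTransmission := by
  intro ω₂ lam β γ hω hl hβ hγ T hT
  have hA := stub_noBallisticPrecursor ω₂ lam β γ hω hl hβ hγ T hT
  have hB := stub_diffusiveWindowLimit ω₂ lam β γ hω hl hβ hγ T hT
  intro P Kt X
  exact tendsto_of_precursor_and_window X hA hB

end Summit.AtomisticToContinuum.FouriersLaw.Cruxes.FiniteHorizonTransmission.Birth
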